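import Literature.Geometry.Lorentzian.KerrObstructionNonlinear
import Literature.Geometry.Lorentzian.KerrObstructionInnerLayer
import Literature.Geometry.Lorentzian.KerrCylinderParameterClosenessK
import Literature.Geometry.Lorentzian.KerrCylinderFamilyContinuity
import HarnessLib

/-!
# First-jet bounds for the perturbation in Li–Mei's obstruction: `η = O(ε)`

Support file (all results proved; no named facts) for the named fact `LiMei.interiorKerrGluing`
(`InteriorKerrGluing.lean`; J. Li, H. Mei, *A construction of collapsing spacetimes in vacuum*,
Comm. Math. Phys. 378 (2020) = arXiv:2005.01249, Prop. 4.1), Step S5 of the architecture recorded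
in `InteriorKerrGluingReduction.lean`. `KerrObstructionNonlinear.lean` bounds the nonlinear
remainder of the obstruction by `C η²`, `η` a bound for the first jets
`J(γ,κ)(y) = (γ(y), Dγ(y), κ(y), Dκ(y))` of the perturbation on the shell. Here `η = O(ε)`:

* `LiMei.opNorm_le_of_unit_bound₂`, `LiMei.fderiv_apply₂` — operator norms of (derivatives of)
  bilinear-form fields from bounds on unit vectors;
* **`LiMei.norm_jetAt_le_of_nearSchwarzschildCylinder`** — a datum `ε`-close in `C^k`, `k ≥ 1`,
  to the Schwarzschild cylinder on `{ρ₁ < ‖y‖ < ρ₂}` has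
  `‖J(D.coordH − G₀, D.coordK − K₀)(y)‖ ≤ ε` there;
* **`LiMei.exists_norm_jetAt_preGluedDatum_le`** — for the pre-glued datum of parameters
  `p = (δm, b)` plus any correction `(γ₁, κ₁)`:
  `‖J(D̃(p) + (γ₁,κ₁) − (G₀,K₀))(y)‖ ≤ C (ε + |δm| + ‖b‖) + ‖J(γ₁,κ₁)(y)‖` on the shell, for
  `|δm| + ‖b‖ ≤ δ` (from `nearSchwarzschildCylinder_preGluedDatum_of_parameters`, Li–Mei p. 22).

With `‖p‖ ≤ C₀ε` and a Corvino–Schoen correction of `C¹`-size `O(ε)` this is `η = O(ε)`, hence the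
nonlinear remainder is `O(ε²)` (Li–Mei p. 25).

## References

* J. Li, H. Mei, arXiv:2005.01249, §4, proof of Prop. 4.1, pp. 22, 25. [LiMei2020]
-/

noncomputable section

set_option maxSynthPendingDepth 3

open Set Filter Function Metric MeasureTheory ContinuousLinearMap Module
open scoped Topology RealInnerProductSpace Real Manifold ContDiff

namespace Literature.Geometry.Lorentzian

namespace LiMei

open MetricCoord

attribute [local instance] instNormedAddCommGroupBilinE3 instNormedSpaceBilinE3

/-! ### Operator norms from unit-vector bounds -/

/-- The operator norm of a bilinear form from a bound on unit vectors. [folklore] -/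
theorem opNorm_le_of_unit_bound₂ (β : E3 →L[ℝ] E3 →L[ℝ] ℝ) {C : ℝ} (hC : 0 ≤ C)
    (h : ∀ v w : E3, ‖v‖ ≤ 1 → ‖w‖ ≤ 1 → |β v w| ≤ C) : ‖β‖ ≤ C := by
  refine ContinuousLinearMap.opNorm_le_bound _ hC fun v ↦ ?_
  refine ContinuousLinearMap.opNorm_le_bound _ (by positivity) fun w ↦ ?_
  rw [Real.norm_eq_abs, apply_eq_norm_mul_norm_mul β v w, abs_mul, abs_mul, abs_norm, abs_norm]
  calc ‖v‖ * ‖w‖ * |β (‖v‖⁻¹ • v) (‖w‖⁻¹ • w)| ≤ ‖v‖ * ‖w‖ * C := by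
        gcongr
        exact h _ _ (norm_unitDir_le_one v) (norm_unitDir_le_one w)
    _ = C * ‖v‖ * ‖w‖ := by ring

/-- **Evaluation commutes with differentiation**: `D(z ↦ γ(z)(v,w))(y) h = (Dγ(y) h)(v, w)`.
[folklore] -/
theorem fderiv_apply₂ {γ : E3 → E3 →L[ℝ] E3 →L[ℝ] ℝ} {y : E3} (hγ : DifferentiableAt ℝ γ y)
    (v w h : E3) : fderiv ℝ (fun z ↦ γ z v w) y h = fderiv ℝ γ y h v w := by
  have h1 : HasFDerivAt (fun z ↦ γ z v) ((fderiv ℝ γ y).flip v) y := by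
    simpa using hγ.hasFDerivAt.clm_apply (hasFDerivAt_const v y)
  have h2 : HasFDerivAt (fun z ↦ γ z v w) (((fderiv ℝ γ y).flip v).flip w) y := by
    simpa using h1.clm_apply (hasFDerivAt_const w y)
  rw [h2.fderiv]
  rfl

/-- `‖Dγ(y)‖ ≤ C` from bounds `|D(z ↦ γ(z)(v,w))(y) h| ≤ C ‖h‖` on unit `v, w`. [folklore] -/
theorem opNorm_fderiv_le_of_unit_bound {γ : E3 → E3 →L[ℝ] E3 →L[ℝ] ℝ} {y : E3}
    (hγ : DifferentiableAt ℝ γ y) {C : ℝ} (hC : 0 ≤ C)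
    (h : ∀ v w : E3, ‖v‖ ≤ 1 → ‖w‖ ≤ 1 → ∀ h : E3, |fderiv ℝ (fun z ↦ γ z v w) y h| ≤ C * ‖h‖) :
    ‖fderiv ℝ γ y‖ ≤ C := by
  refine ContinuousLinearMap.opNorm_le_bound _ hC fun u ↦ ?_
  refine opNorm_le_of_unit_bound₂ _ (by positivity) fun v w hv hw ↦ ?_
  rw [← fderiv_apply₂ hγ v w u]
  exact h v w hv hw u

/-- `‖iteratedFDeriv ℝ 1 f y‖ = ‖fderiv ℝ f y‖`. [folklore] -/
theorem norm_iteratedFDeriv_one_eq {F : Type*} [NormedAddCommGroup F] [NormedSpace ℝ F]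
    (f : E3 → F) (y : E3) : ‖iteratedFDeriv ℝ 1 f y‖ = ‖fderiv ℝ f y‖ := by
  rw [← norm_iteratedFDeriv_fderiv, norm_iteratedFDeriv_zero]

/-! ### Jets of a datum close to the Schwarzschild cylinder -/

section Near

variable [Kerr.Facts]

/-- **A datum `ε`-close in `C^k` (`k ≥ 1`) to the Schwarzschild cylinder has first jets of
`(D.coordH − G₀, D.coordK − K₀)` bounded by `ε`** on the shell `{ρ₁ < ‖y‖ < ρ₂}` (`1 ≤ ρ₁`; the
background written in any frame `R₀`). [cite: LiMei2020, proof of Prop. 4.1, p. 22] -/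
theorem norm_jetAt_le_of_nearSchwarzschildCylinder {M r₁ r₀ ρ₁ ρ₂ : ℝ} {k : ℕ} {ε : ℝ}
    (hr₁ : r₁ < r₀) (hr₀ : 0 < r₀) (h2M : r₀ < 2 * M) (hρ₁ : 1 ≤ ρ₁) (hk : 1 ≤ k) (τ₀ : ℝ)
    (R₀ : E3 →ₗᵢ[ℝ] E3) {D : InitialDataSet (𝓡 3) E3}
    (hD : NearSchwarzschildCylinder M r₁ r₀ ρ₁ ρ₂ k ε D) {y : E3} (hy₁ : ρ₁ < ‖y‖)
    (hy₂ : ‖y‖ < ρ₂) :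
    ‖jetAt (fun z ↦ D.coordH z - cylH M 0 r₀ τ₀ R₀ z) (fun z ↦ D.coordK z - cylK M 0 hr₀ τ₀ R₀ z)
      y‖ ≤ ε := by
  have H := (nearSchwarzschildCylinder_iff hr₁ hr₀ h2M hρ₁ D).1 hD
  have hy1 : 1 < ‖y‖ := lt_of_le_of_lt hρ₁ hy₁
  have hε0 : 0 ≤ ε := (norm_nonneg _).trans (H 0 0 (by simp) (by simp) 0 (Nat.zero_le _) y hy₁ hy₂).1
  have hG := isMetricOn_cylH_zero_spin hr₀ h2M τ₀ R₀
  have hopen : IsOpen {z : E3 | 1 < ‖z‖} := isOpen_lt continuous_const continuous_norm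
  have hyn : {z : E3 | 1 < ‖z‖} ∈ 𝓝 y := hopen.mem_nhds hy1
  set γ : E3 → E3 →L[ℝ] E3 →L[ℝ] ℝ := fun z ↦ D.coordH z - cylH M 0 r₀ τ₀ R₀ z with hγ
  set κ : E3 → E3 →L[ℝ] E3 →L[ℝ] ℝ := fun z ↦ D.coordK z - cylK M 0 hr₀ τ₀ R₀ z with hκ
  have hdγ : DifferentiableAt ℝ γ y :=
    D.contDiff_coordH.contDiffAt.differentiableAt (by simp) |>.sub
      ((hG.contDiffOn.contDiffAt hyn).differentiableAt (by simp))
  have hdκ : DifferentiableAt ℝ κ y :=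
    D.contDiff_coordK.contDiffAt.differentiableAt (by simp) |>.sub
      ((contDiff_cylK_zero_spin hr₀ h2M τ₀ R₀).contDiffAt.differentiableAt (by simp))
  -- the component functions agree with those of the `Near` predicate near `y`
  have heγ : ∀ v w : E3, (fun z ↦ γ z v w) =ᶠ[𝓝 y] fun z ↦ D.h.inner z v w - gbarRep M r₀ z v w := by
    intro v w
    filter_upwards [hyn] with z hz
    simp only [hγ, sub_apply, InitialDataSet.coordH_apply, cylH_zero_spin_apply hr₀ τ₀ R₀ (le_of_lt hz)]
  have heκ : ∀ v w : E3, (fun z ↦ κ z v w) =ᶠ[𝓝 y] fun z ↦ D.k z v w - kbarRep M r₀ z v w := by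
    intro v w
    filter_upwards [hyn] with z hz
    simp only [hκ, sub_apply, InitialDataSet.coordK_apply, cylK_zero_spin_apply hr₀ h2M τ₀ R₀ hz]
  -- order zero
  have h0γ : ‖γ y‖ ≤ ε := by
    refine opNorm_le_of_unit_bound₂ _ hε0 fun v w hv hw ↦ ?_
    have h := (H v w hv hw 0 (Nat.zero_le _) y hy₁ hy₂).1
    rw [norm_iteratedFDeriv_zero, Real.norm_eq_abs] at h
    rwa [(heγ v w).eq_of_nhds]
  have h0κ : ‖κ y‖ ≤ ε := by
    refine opNorm_le_of_unit_bound₂ _ hε0 fun v w hv hw ↦ ?_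
    have h := (H v w hv hw 0 (Nat.zero_le _) y hy₁ hy₂).2
    rw [norm_iteratedFDeriv_zero, Real.norm_eq_abs] at h
    rwa [(heκ v w).eq_of_nhds]
  -- order one
  have h1γ : ‖fderiv ℝ γ y‖ ≤ ε := by
    refine opNorm_fderiv_le_of_unit_bound hdγ hε0 fun v w hv hw u ↦ ?_
    have h := (H v w hv hw 1 hk y hy₁ hy₂).1
    rw [norm_iteratedFDeriv_one_eq] at h
    rw [(heγ v w).fderiv_eq, ← Real.norm_eq_abs]
    exact (le_opNorm _ _).trans (mul_le_mul_of_nonneg_right h (norm_nonneg _))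
  have h1κ : ‖fderiv ℝ κ y‖ ≤ ε := by
    refine opNorm_fderiv_le_of_unit_bound hdκ hε0 fun v w hv hw u ↦ ?_
    have h := (H v w hv hw 1 hk y hy₁ hy₂).2
    rw [norm_iteratedFDeriv_one_eq] at h
    rw [(heκ v w).fderiv_eq, ← Real.norm_eq_abs]
    exact (le_opNorm _ _).trans (mul_le_mul_of_nonneg_right h (norm_nonneg _))
  simp only [jetAt, Prod.norm_def]
  exact max_le h0γ (max_le h1γ (max_le h0κ h1κ))

/-- **`η = O(ε + |p|) + ‖J(γ₁,κ₁)‖` for the pre-glued datum plus a correction.** For radii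
`0 < r₁ < r₀ < 2M`, `1 ≤ ρ₁`, `ρ₂`, gluing radii `c₁, c₂`, `k ≥ 1`, there are `δ > 0`, `C ≥ 0`:
for every `D` that is `ε`-close (`ε ≥ 0`), every `p = (δm, b)` with `|δm| + ‖b‖ ≤ δ`, all
admissibility proofs, every correction `(γ₁, κ₁)` differentiable at `y`, and `ρ₁ < ‖y‖ < ρ₂`:
`‖J(D̃(p).coordH − G₀ + γ₁, D̃(p).coordK − K₀ + κ₁)(y)‖ ≤ C (ε + |δm| + ‖b‖) + ‖J(γ₁,κ₁)(y)‖`.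
[cite: LiMei2020, proof of Prop. 4.1, pp. 22, 25] -/
theorem exists_norm_jetAt_preGluedDatum_le {M r₁ r₀ ρ₁ : ℝ} (hr₁ : 0 < r₁) (hr₁₀ : r₁ < r₀)
    (h2M : r₀ < 2 * M) (hρ₁ : 1 ≤ ρ₁) (ρ₂ τ₀ : ℝ) (R₀ : E3 →ₗᵢ[ℝ] E3) (c₁ c₂ : ℝ) {k : ℕ}
    (hk : 1 ≤ k) :
    ∃ δ C : ℝ, 0 < δ ∧ 0 ≤ C ∧ ∀ (ε : ℝ) (D : InitialDataSet (𝓡 3) E3), 0 ≤ ε →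
      NearSchwarzschildCylinder M r₁ r₀ ρ₁ ρ₂ k ε D →
      ∀ p : ℝ × E3, |p.1| + ‖p.2‖ ≤ δ →
        ∀ (ha : |‖p.2‖| < M + p.1) (h₁ : Kerr.rMinus (M + p.1) ‖p.2‖ < r₀)
          (h₂ : r₀ < Kerr.rPlus (M + p.1) ‖p.2‖) (γ₁ κ₁ : E3 → E3 →L[ℝ] E3 →L[ℝ] ℝ) (y : E3),
          DifferentiableAt ℝ γ₁ y → DifferentiableAt ℝ κ₁ y → ρ₁ < ‖y‖ → ‖y‖ < ρ₂ →
          ‖jetAt (fun z ↦ (preGluedDatum ha h₁ h₂ τ₀ (spinIsometry p.2) c₁ c₂ D).coordH z -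
                cylH M 0 r₀ τ₀ R₀ z + γ₁ z)
              (fun z ↦ (preGluedDatum ha h₁ h₂ τ₀ (spinIsometry p.2) c₁ c₂ D).coordK z -
                cylK M 0 (hr₁.trans hr₁₀) τ₀ R₀ z + κ₁ z) y‖ ≤
            C * (ε + (|p.1| + ‖p.2‖)) + ‖jetAt γ₁ κ₁ y‖ := by
  have hr₀ : 0 < r₀ := hr₁.trans hr₁₀
  obtain ⟨δ, C, hδ, hC, hnear⟩ :=
    nearSchwarzschildCylinder_preGluedDatum_of_parameters hr₁ hr₁₀ h2M hρ₁ ρ₂ τ₀ c₁ c₂ k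
  refine ⟨δ, C, hδ, hC, fun ε D hε hD p hp ha h₁ h₂ γ₁ κ₁ y hγ₁ hκ₁ hy₁ hy₂ ↦ ?_⟩
  have hp' : |M + p.1 - M| + |‖p.2‖| ≤ δ := by rwa [add_sub_cancel_left, abs_norm]
  have hN := hnear ε D hε hD (M + p.1) ‖p.2‖ ha h₁ h₂ hp' (spinIsometry p.2)
  set D' := preGluedDatum ha h₁ h₂ τ₀ (spinIsometry p.2) c₁ c₂ D with hD'
  have hJ := norm_jetAt_le_of_nearSchwarzschildCylinder hr₁₀ hr₀ h2M hρ₁ hk τ₀ R₀ hN hy₁ hy₂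
  rw [add_sub_cancel_left, abs_norm] at hJ
  -- differentiability of the datum part at `y`
  have hy1 : 1 < ‖y‖ := lt_of_le_of_lt hρ₁ hy₁
  have hyn : {z : E3 | 1 < ‖z‖} ∈ 𝓝 y := (isOpen_lt continuous_const continuous_norm).mem_nhds hy1
  have hG := isMetricOn_cylH_zero_spin hr₀ h2M τ₀ R₀
  have hdγ : DifferentiableAt ℝ (fun z ↦ D'.coordH z - cylH M 0 r₀ τ₀ R₀ z) y :=
    D'.contDiff_coordH.contDiffAt.differentiableAt (by simp) |>.sub
      ((hG.contDiffOn.contDiffAt hyn).differentiableAt (by simp))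
  have hdκ : DifferentiableAt ℝ (fun z ↦ D'.coordK z - cylK M 0 hr₀ τ₀ R₀ z) y :=
    D'.contDiff_coordK.contDiffAt.differentiableAt (by simp) |>.sub
      ((contDiff_cylK_zero_spin hr₀ h2M τ₀ R₀).contDiffAt.differentiableAt (by simp))
  have hsum : jetAt (fun z ↦ D'.coordH z - cylH M 0 r₀ τ₀ R₀ z + γ₁ z)
      (fun z ↦ D'.coordK z - cylK M 0 hr₀ τ₀ R₀ z + κ₁ z) y =
      jetAt (fun z ↦ D'.coordH z - cylH M 0 r₀ τ₀ R₀ z) (fun z ↦ D'.coordK z - cylK M 0 hr₀ τ₀ R₀ z) y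
        + jetAt γ₁ κ₁ y := by
    rw [← jetAt_add hdγ hγ₁ hdκ hκ₁]
    rfl
  rw [hsum]
  exact (norm_add_le _ _).trans (add_le_add hJ le_rfl)

end Near

end LiMei

end Literature.Geometry.Lorentzian

end
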